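import Summits.HodgeConjecture.HodgeConjecture.Theorems.Ring2AtlasSixfolds
import Summits.HodgeConjecture.HodgeConjecture.Theorems.Ring2DeformClassTargets
import Summits.HodgeConjecture.HodgeConjecture.Theorems.Ring2HypothesesCMPowerClosure
import Literature.AlgebraicGeometry.HodgeTheory.SimplePrimeDimensionHodgeClasses
import Literature.AlgebraicGeometry.Motives.AbelianVarietyProductIsogeny
import HarnessLib

/-!
# Ring 2 · deform axis, part IX — the localised row U on the atlas-2 cells (`g = 6, 7`) and their free CM fibres

HONEST FRAMING (cell `pub-hodge-ring2`, verbatim): research route conditional on HC_CM; not a corollary;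
Q11.4-sentence-2 already refuted in dim ≥ 3.

`HC_CM` := `Theses.RankFourFaces.CMAbelianHodge` (stmt-HodgeConjecture-3052) is a HYPOTHESIS `(hCM : …)` wherever it
occurs below, never a cited fact; `HC_AV` := `Theses.PadicSemiregularLift.HodgeAbelianVarieties`
(stmt-HodgeConjecture-1333); the item served is stmt-HodgeConjecture-16267 (`Theses.RankFourFaces.CMToAbelian`), as a
helper. Fact #20 := `Literature.AlgebraicGeometry.Deligne1982.deligne1982_cmDenseMumfordTateFamilies` (a hypothesis
`(hF : …)`, exactly as in parts VII/VIII).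

WHAT THIS PART ADDS (theorems only; no definition, no new `@[conjecture]` node, no `sorry`).

§1 BY-NAME TWINS FOR THE SIX ATLAS-2 CELLS (`Theorems/Ring2AtlasSixfolds.lean`, rows `g = 6, 7`): for each cell `𝒞`,
`𝒞 ↔ (localised row U on the members of 𝒞)` modulo `hCM` + `hF` — part VII's exactness
`HC(A) ↔ CMSpreadingAt A` (`hodgeConjectureFor_iff_cmSpreadingAt_of_HC_CM`) read on the cell's binders verbatim — and
the unconditional on-path direction `𝒞 → (localised row U on 𝒞)`. Atlas columns (c6)/(c7) for these rows in
kernel form (RING2-MAP §deform gen 12, D.41).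

§2 THE CM FIBRES OF THESE CELLS ARE (MOSTLY) FREE ANCHORS — the Hodge conjecture holds there WITHOUT `HC_CM`, so on
the Mumford–Tate family through a member the deformation input (1.1) alone carries HC (KIND 1 of D.34/D.41):
* `k`-LINE CELLS (`E × Y₅`, `Y₃ × Y₃'`, `E × Y₆`, all powers): the unitary families `U(a,b)` over `k` contain a dense
  set of CM points whose fibre is isogenous to a power of ONE elliptic curve `E` with CM by `k` (diagonal hermitian
  forms; D.41); there HC is UNCONDITIONAL in the tree (van Geemen Thm. 4.3 via typer 2's generation criterion):
  `hodgeConjectureFor_powSucc_prod_of_isIsogenous_powSucc_of_cm` (`(E × Y₀)^{M+1}`, `Y₀ ~ E^{K+1}`) and the product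
  form for `Y₀ × Y₀'`.
* TYPE III(1) SIXFOLDS: every CM fibre of the PEL threefold `S_{D,Ψ}` is isogenous to a SQUARE `B²` of a CM threefold
  (`V ≅ M²` for a maximal commutative `*`-subalgebra `M ⊂ M₃(D)`; D.41); for `B` SIMPLE, HC on all powers of `B` is the
  refereed named fact Tankeev–Ribet (prime `3`): `hodgeConjectureFor_of_isIsogenous_powSucc_simplePrimeDim_of_tankeevRibet`.
* THE K3-PARTNER CELL (`Y × Z_Y`, `End⁰(Y) = E` quartic CM) AT `E` CYCLIC: at the `E × E`-tori of the Shimura curve of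
  `Y` the fibre is `Y₀ × Z_Y ~ (B × B) × B`, `B` the simple CM surface with CM by `E` (ONE isogeny class: Moonen–Zarhin
  1999 §4, the quartic-CM-field dichotomy preceding the Proposition on `X₁ × X₂` — "In case (1) [`F` Galois, `Aut(F)`
  cyclic of order 4] there is only one isogeny class of abelian surfaces with CM by `F`", arXiv:math/9901113 p. 8;
  NOT §5 "Case 1/2", which is the `E × Y` fivefold analysis, arXiv p. 10 — cell referee F44); HC there is
  Tankeev–Ribet at prime `2`: `hodgeConjectureFor_of_isIsogenous_prod_sq_of_tankeevRibet`. (For `E` of type `D₄` the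
  fibres `B₁ × B₂ × Z_Y` carry exceptional classes and are NOT free — there `HC_CM` is load-bearing; RING2-MAP D.41.)
  A member `X = Y × Z` is — like every abelian variety — the base fibre of its own Mumford–Tate family, on which each
  of its Hodge classes extends to a fibrewise-Hodge global class (fact #20, per class); as `Y` is never of CM type
  (`[E:ℚ] = 4 < 8`) that family lives over a Shimura CURVE, not a point, so the four K3-partner classes are flat
  along the whole pencil `{Y_λ × Z_Y}` (RING2-MAP §deform gen 13, D.46: reading only, nothing of it is used here).
Family forms put such fibres in typer 2's `anchorLocus`, where part VII's `cmSpreadingTo_of_mem_anchorLocus` makes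
the localised row U tautological.

All statements keep `HC_CM` as the binder `hCM`; nothing here decides `HC_CM`, `HC_AV` or any cell. Which CM points
lie on which family is mathematics recorded (with two-method certification) in RING2-MAP §deform D.41, not asserted
in the kernel: the theorems below take the isogeny shape of the fibre as a HYPOTHESIS.

Sources: [Deligne 1982, §5 Thm. 5.3, §6 Prop. 6.1, Thm. 2.11]; [Charles–Schnell 2014 = arXiv:1101.3647, Thm. 11.5.11,
Prop. 11.3.11]; [van Geemen 1994, LNM 1594, Lemma 3.7, Thm. 4.3, Thm. 4.6]; [Moonen–Zarhin 1999 = arXiv:math/9901113,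
§2 (2.7); §3 (3.8); §4 (CM types of a quartic CM field and the isogeny classes of simple CM surfaces, arXiv pp. 7–8);
§5 (products of dimension ≤ 5, the `E × Y` analysis "Case 1/2", arXiv p. 10)]; [Gordon 1997, §3]; [Mumford 1969, §3];
[Deligne 2000, §1].
-/

set_option linter.dupNamespace false

noncomputable section

namespace Summit.HodgeConjecture.HodgeConjecture.Ring2.Deform

open CategoryTheory AlgebraicGeometry
open Literature.AlgebraicGeometry Literature.AlgebraicGeometry.Motives
open Literature.AlgebraicGeometry.HodgeTheory
open Literature.AlgebraicGeometry.Milne1999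
open Literature.AlgebraicTopology.SingularHomology
open Literature.AlgebraicGeometry.Deligne1982 (deligne1982_cmDenseMumfordTateFamilies)
open Summit.HodgeConjecture.HodgeConjecture
open Summit.HodgeConjecture.HodgeConjecture.Theses
open Summit.HodgeConjecture.HodgeConjecture.Ring2.ClassTargets
open Summit.HodgeConjecture.HodgeConjecture.Ring2.Motiv
open Summit.HodgeConjecture.HodgeConjecture.Ring2.Hypotheses (anchorLocus mem_anchorLocus_of_chart)

/-! ## §1 The six atlas-2 cells: `cell ↔ localised row U on the cell` (mod `HC_CM` + #20), and on path -/

/-- **Cell g6.III(1) / II — quaternion sixfolds.** Modulo `HC_CM` (binder) and #20, HC for the simple sixfolds with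
non-commutative endomorphism algebra and no type-IV factor is EXACTLY the localised row U on that class.
[cite: Deligne1982HodgeCycles, §6 Prop. 6.1] [cite: CharlesSchnell2014Notes, Thm. 11.5.11, Prop. 11.3.11] -/
theorem hodgeQuaternionSixfold_iff_cmSpreading_of_HC_CM (hCM : RankFourFaces.CMAbelianHodge)
    (hF : deligne1982_cmDenseMumfordTateFamilies) :
    Atlas.HodgeQuaternionSixfold ↔
      ∀ A : AbelianVariety ℂ,
        (A.dim = 6 ∧ A.IsSimple ∧ (∃ ψ χ : A ⟶ A, ψ ≫ χ ≠ χ ≫ ψ) ∧ HasNoTypeIVFactor A) → CMSpreadingAt A :=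
  (hcOnClass_iff _).trans (hcOnClass_iff_cmSpreadingOn_of_HC_CM hCM hF _)

/-- ON-PATH, unconditionally: the quaternion-sixfold cell gives the localised row U on its members.
[cite: Deligne2000, §1] -/
theorem cmSpreading_of_hodgeQuaternionSixfold (h : Atlas.HodgeQuaternionSixfold) :
    ∀ A : AbelianVariety ℂ,
      (A.dim = 6 ∧ A.IsSimple ∧ (∃ ψ χ : A ⟶ A, ψ ≫ χ ≠ χ ≫ ψ) ∧ HasNoTypeIVFactor A) → CMSpreadingAt A :=
  cmSpreadingOn_of_hcOnClass _ ((hcOnClass_iff _).1 h)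

/-- **Cell g6.IV(3,1), the `k`-Weil members.** Modulo `HC_CM` (binder) and #20, HC for the simple sixfolds with
sextic endomorphism field on which `k = ℚ(√-d)` acts with multiplicities `(3,3)` is EXACTLY the localised row U
there. [cite: Deligne1982HodgeCycles, §6 Prop. 6.1] [cite: MoonenZarhin1998WeilClasses, Criterion (4.1)] -/
theorem hodgeSexticFieldWeilSixfold_iff_cmSpreading_of_HC_CM (hCM : RankFourFaces.CMAbelianHodge)
    (hF : deligne1982_cmDenseMumfordTateFamilies) :
    Atlas.HodgeSexticFieldWeilSixfold ↔
      ∀ (A : AbelianVariety ℂ) (φ : A ⟶ A) (d : ℕ), 0 < d → A.dim = 6 → A.IsSimple → IsField A.endAlgebra →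
        Module.finrank ℚ A.endAlgebra = 6 → φ ≫ φ = -(d • 𝟙 A) →
        HodgeTheory.eigenMultiplicity A φ (Complex.I * (Real.sqrt d : ℂ)) = 3 → CMSpreadingAt A :=
  ⟨fun h A φ d hd hA hs hf hr hφ hm ↦ cmSpreadingAt_of_hodgeConjectureFor (h A φ d hd hA hs hf hr hφ hm),
    fun h A φ d hd hA hs hf hr hφ hm ↦
      hodgeConjectureFor_of_HC_CM_of_cmSpreadingAt hCM hF (h A φ d hd hA hs hf hr hφ hm)⟩

/-- ON-PATH, unconditionally: the sextic-field Weil cell gives the localised row U on its members.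
[cite: Deligne2000, §1] -/
theorem cmSpreading_of_hodgeSexticFieldWeilSixfold (h : Atlas.HodgeSexticFieldWeilSixfold) :
    ∀ (A : AbelianVariety ℂ) (φ : A ⟶ A) (d : ℕ), 0 < d → A.dim = 6 → A.IsSimple → IsField A.endAlgebra →
      Module.finrank ℚ A.endAlgebra = 6 → φ ≫ φ = -(d • 𝟙 A) →
      HodgeTheory.eigenMultiplicity A φ (Complex.I * (Real.sqrt d : ℂ)) = 3 → CMSpreadingAt A :=
  fun A φ d hd hA hs hf hr hφ hm ↦ cmSpreadingAt_of_hodgeConjectureFor (h A φ d hd hA hs hf hr hφ hm)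

/-- **Cell g6 = IV(2,1) quartic-field fourfold × CM surface (the K3-partner row).** Modulo `HC_CM` (binder) and
#20, HC on the motiv product cell `ProdCMCell IsQuarticFieldTypeIVFourfold (dim = 2)` is EXACTLY the localised
row U on it. Its CM fibres at `E` cyclic are free (§2). [cite: Deligne1982HodgeCycles, §6 Prop. 6.1]
[cite: MoonenZarhin1999LowDim, §4 (quartic-CM-field dichotomy preceding the Proposition on X₁ × X₂, arXiv p. 8)] -/
theorem hodgeQuarticTypeIVFourfoldTimesCMSurface_iff_cmSpreading_of_HC_CM (hCM : RankFourFaces.CMAbelianHodge)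
    (hF : deligne1982_cmDenseMumfordTateFamilies) :
    Atlas.HodgeQuarticTypeIVFourfoldTimesCMSurface ↔
      ∀ X : AbelianVariety ℂ,
        ProdCMCell Atlas.IsQuarticFieldTypeIVFourfold (fun Z ↦ Z.dim = 2) X → CMSpreadingAt X :=
  (hcOnClass_iff _).trans (hcOnClass_iff_cmSpreadingOn_of_HC_CM hCM hF _)

/-- ON-PATH, unconditionally: the K3-partner cell gives the localised row U on its members. [cite: Deligne2000, §1] -/
theorem cmSpreading_of_hodgeQuarticTypeIVFourfoldTimesCMSurface (h : Atlas.HodgeQuarticTypeIVFourfoldTimesCMSurface) :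
    ∀ X : AbelianVariety ℂ,
      ProdCMCell Atlas.IsQuarticFieldTypeIVFourfold (fun Z ↦ Z.dim = 2) X → CMSpreadingAt X :=
  cmSpreadingOn_of_hcOnClass _ ((hcOnClass_iff _).1 h)

/-- **Cell g6 = E × Y₅ (`k`-line) × powers.** Modulo `HC_CM` (binder) and #20, HC for all powers of `E × Y`,
`E` and the simple fivefold `Y` with multiplication by the same `k`, is EXACTLY the localised row U at those powers.
Its CM fibres `~ E^{6(N+1)}` are free (§2). [cite: Deligne1982HodgeCycles, §6 Prop. 6.1] [cite: MoonenZarhin1999LowDim, §5] -/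
theorem hodgePowersOfCMEllipticTimesUnitaryFivefold_iff_cmSpreading_of_HC_CM (hCM : RankFourFaces.CMAbelianHodge)
    (hF : deligne1982_cmDenseMumfordTateFamilies) :
    Atlas.HodgePowersOfCMEllipticTimesUnitaryFivefold ↔
      ∀ (E Y : AbelianVariety ℂ) (φ : E ⟶ E) (ψ : Y ⟶ Y) (d : ℕ), 0 < d → E.dim = 1 → Y.dim = 5 → Y.IsSimple →
        φ ≫ φ = -(d • 𝟙 E) → ψ ≫ ψ = -(d • 𝟙 Y) → ∀ N : ℕ, CMSpreadingAt ((E.prod Y).powSucc N) :=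
  ⟨fun h E Y φ ψ d hd hE hY hs hφ hψ N ↦ cmSpreadingAt_of_hodgeConjectureFor (h E Y φ ψ d hd hE hY hs hφ hψ N),
    fun h E Y φ ψ d hd hE hY hs hφ hψ N ↦
      hodgeConjectureFor_of_HC_CM_of_cmSpreadingAt hCM hF (h E Y φ ψ d hd hE hY hs hφ hψ N)⟩

/-- ON-PATH, unconditionally: the `E × Y₅` cell gives the localised row U on its members. [cite: Deligne2000, §1] -/
theorem cmSpreading_of_hodgePowersOfCMEllipticTimesUnitaryFivefold
    (h : Atlas.HodgePowersOfCMEllipticTimesUnitaryFivefold) :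
    ∀ (E Y : AbelianVariety ℂ) (φ : E ⟶ E) (ψ : Y ⟶ Y) (d : ℕ), 0 < d → E.dim = 1 → Y.dim = 5 → Y.IsSimple →
      φ ≫ φ = -(d • 𝟙 E) → ψ ≫ ψ = -(d • 𝟙 Y) → ∀ N : ℕ, CMSpreadingAt ((E.prod Y).powSucc N) :=
  fun E Y φ ψ d hd hE hY hs hφ hψ N ↦ cmSpreadingAt_of_hodgeConjectureFor (h E Y φ ψ d hd hE hY hs hφ hψ N)

/-- **Cell g6 = Y₃ × Y₃' (two unitary threefolds over the same `k`).** Modulo `HC_CM` (binder) and #20, HC for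
`Y × Y'` is EXACTLY the localised row U at `Y × Y'`. Its CM fibres `~ E³ × E³` (`Y'` not CM) are free (§2).
[cite: Deligne1982HodgeCycles, §6 Prop. 6.1] [cite: MoonenZarhin1999LowDim, §5] -/
theorem hodgeUnitaryThreefoldPair_iff_cmSpreading_of_HC_CM (hCM : RankFourFaces.CMAbelianHodge)
    (hF : deligne1982_cmDenseMumfordTateFamilies) :
    Atlas.HodgeUnitaryThreefoldPair ↔
      ∀ (Y Y' : AbelianVariety ℂ) (ψ : Y ⟶ Y) (ψ' : Y' ⟶ Y') (d : ℕ), 0 < d → Y.dim = 3 → Y'.dim = 3 →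
        Y.IsSimple → Y'.IsSimple → ¬ AbelianVariety.IsIsogenous Y Y' →
        ψ ≫ ψ = -(d • 𝟙 Y) → ψ' ≫ ψ' = -(d • 𝟙 Y') → CMSpreadingAt (Y.prod Y') :=
  ⟨fun h Y Y' ψ ψ' d hd hY hY' hs hs' hn hψ hψ' ↦
      cmSpreadingAt_of_hodgeConjectureFor (h Y Y' ψ ψ' d hd hY hY' hs hs' hn hψ hψ'),
    fun h Y Y' ψ ψ' d hd hY hY' hs hs' hn hψ hψ' ↦
      hodgeConjectureFor_of_HC_CM_of_cmSpreadingAt hCM hF (h Y Y' ψ ψ' d hd hY hY' hs hs' hn hψ hψ')⟩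

/-- ON-PATH, unconditionally: the threefold-pair cell gives the localised row U on its members. [cite: Deligne2000, §1] -/
theorem cmSpreading_of_hodgeUnitaryThreefoldPair (h : Atlas.HodgeUnitaryThreefoldPair) :
    ∀ (Y Y' : AbelianVariety ℂ) (ψ : Y ⟶ Y) (ψ' : Y' ⟶ Y') (d : ℕ), 0 < d → Y.dim = 3 → Y'.dim = 3 →
      Y.IsSimple → Y'.IsSimple → ¬ AbelianVariety.IsIsogenous Y Y' →
      ψ ≫ ψ = -(d • 𝟙 Y) → ψ' ≫ ψ' = -(d • 𝟙 Y') → CMSpreadingAt (Y.prod Y') :=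
  fun Y Y' ψ ψ' d hd hY hY' hs hs' hn hψ hψ' ↦
    cmSpreadingAt_of_hodgeConjectureFor (h Y Y' ψ ψ' d hd hY hY' hs hs' hn hψ hψ')

/-- **Cell g7 = E × Y₆ (`k`-line) × powers.** Modulo `HC_CM` (binder) and #20, HC for all powers of `E × Y`, `Y` a
simple sixfold with multiplication by the same `k`, is EXACTLY the localised row U at those powers. Its CM fibres
`~ E^{7(N+1)}` are free (§2). [cite: Deligne1982HodgeCycles, §6 Prop. 6.1] [cite: MoonenZarhin1999LowDim, §3 (3.8)] -/
theorem hodgePowersOfCMEllipticTimesUnitarySixfold_iff_cmSpreading_of_HC_CM (hCM : RankFourFaces.CMAbelianHodge)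
    (hF : deligne1982_cmDenseMumfordTateFamilies) :
    Atlas.HodgePowersOfCMEllipticTimesUnitarySixfold ↔
      ∀ (E Y : AbelianVariety ℂ) (φ : E ⟶ E) (ψ : Y ⟶ Y) (d : ℕ), 0 < d → E.dim = 1 → Y.dim = 6 → Y.IsSimple →
        φ ≫ φ = -(d • 𝟙 E) → ψ ≫ ψ = -(d • 𝟙 Y) → ∀ N : ℕ, CMSpreadingAt ((E.prod Y).powSucc N) :=
  ⟨fun h E Y φ ψ d hd hE hY hs hφ hψ N ↦ cmSpreadingAt_of_hodgeConjectureFor (h E Y φ ψ d hd hE hY hs hφ hψ N),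
    fun h E Y φ ψ d hd hE hY hs hφ hψ N ↦
      hodgeConjectureFor_of_HC_CM_of_cmSpreadingAt hCM hF (h E Y φ ψ d hd hE hY hs hφ hψ N)⟩

/-- ON-PATH, unconditionally: the `E × Y₆` cell gives the localised row U on its members. [cite: Deligne2000, §1] -/
theorem cmSpreading_of_hodgePowersOfCMEllipticTimesUnitarySixfold
    (h : Atlas.HodgePowersOfCMEllipticTimesUnitarySixfold) :
    ∀ (E Y : AbelianVariety ℂ) (φ : E ⟶ E) (ψ : Y ⟶ Y) (d : ℕ), 0 < d → E.dim = 1 → Y.dim = 6 → Y.IsSimple →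
      φ ≫ φ = -(d • 𝟙 E) → ψ ≫ ψ = -(d • 𝟙 Y) → ∀ N : ℕ, CMSpreadingAt ((E.prod Y).powSucc N) :=
  fun E Y φ ψ d hd hE hY hs hφ hψ N ↦ cmSpreadingAt_of_hodgeConjectureFor (h E Y φ ψ d hd hE hY hs hφ hψ N)

/-- **Atlas-2 at once, on path inside the kernel frame**: `HC_AV` gives the localised row U on every member of every
atlas-2 cell — indeed on every abelian variety (part VII). [cite: Deligne2000, §1] -/
theorem forall_cmSpreadingAt_of_HC_AV (h : PadicSemiregularLift.HodgeAbelianVarieties) :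
    ∀ A : AbelianVariety ℂ, CMSpreadingAt A :=
  fun A ↦ cmSpreadingAt_of_hodgeConjectureFor (h A)

/-! ## §2 Free CM fibres of the atlas-2 cells: HC there WITHOUT `HC_CM` -/

section CMPowers

variable {E : AbelianVariety ℂ} (hE : E.dim = 1) (φ : E ⟶ E) {d : ℕ} (hd : 0 < d) (hφ : φ ≫ φ = -(d • 𝟙 E))
include hE hd hφ

/-- **`k`-line cells at their CM-power fibres: HC for every power of `E × Y₀`, `Y₀ ~ E^{K+1}`, `E` an elliptic curve
with complex multiplication — UNCONDITIONAL.** The CM points of the unitary family `U(a,b)` over `k` with diagonal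
period lattice have fibre `E × Y₀` of this shape (`Y₀ ~ E_k^{a+b}` with the `k`-action twisted to signature `(a,b)`;
RING2-MAP D.41); van Geemen's Thm. 4.3 through typer 2's generation criterion (`Gen_E`, part XII C1/C2) and the
tree's `EllipticCurve.hodgeConjectureFor_of_hodgeOneZero_mem_span_pullback`. No `HC_CM`, no named fact.
[cite: vanGeemen1994HodgeAV, Lemma 3.7 and Thm. 4.3] [cite: Gordon1997, §3] -/
theorem hodgeConjectureFor_powSucc_prod_of_isIsogenous_powSucc_of_cm (K : ℕ) {Y₀ : AbelianVariety ℂ}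
    (hY : Y₀.IsIsogenous (E.powSucc K)) (M : ℕ) :
    HodgeConjectureFor (((E.prod Y₀).powSucc M)).dim ((E.prod Y₀).powSucc M).X :=
  EllipticCurve.hodgeConjectureFor_of_hodgeOneZero_mem_span_pullback hE φ hd hφ ((E.prod Y₀).powSucc M)
    (Hypotheses.AbelianVariety.hodgeOneZero_mem_span_pullback_powSucc_of E (E.prod Y₀)
      (Hypotheses.AbelianVariety.hodgeOneZero_mem_span_pullback_prod_of_isIsogenous_powSucc E
        (a := 0) (AbelianVariety.IsIsogenous.refl E) hY) M)

/-- … hence the localised row U holds at every such fibre, WITHOUT `HC_CM` (cells `E × Y₅`, `E × Y₆` and their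
powers at the CM-power points: KIND 1 on the deformation axis). [cite: vanGeemen1994HodgeAV, Thm. 4.3]
[cite: Deligne1982HodgeCycles, §6 Prop. 6.1] -/
theorem cmSpreadingAt_powSucc_prod_of_isIsogenous_powSucc_of_cm (K : ℕ) {Y₀ : AbelianVariety ℂ}
    (hY : Y₀.IsIsogenous (E.powSucc K)) (M : ℕ) : CMSpreadingAt ((E.prod Y₀).powSucc M) :=
  cmSpreadingAt_of_hodgeConjectureFor (hodgeConjectureFor_powSucc_prod_of_isIsogenous_powSucc_of_cm hE φ hd hφ K hY M)

/-- **Threefold-pair cell at its CM-power fibres: the localised row U holds at `Y₀ × Y₀'`, `Y₀ ~ E^{a+1}`,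
`Y₀' ~ E^{b+1}`, WITHOUT `HC_CM`** (typer 2's `EllipticCurve.hodgeConjectureFor_prod_of_isIsogenous_powSucc_of_cm`;
the fibres `E_k³ × E_k³` of `U(2,1) × U(2,1)`, RING2-MAP D.41). [cite: vanGeemen1994HodgeAV, Thm. 4.3 and §5.3] -/
theorem cmSpreadingAt_prod_of_isIsogenous_powSucc_of_cm {a b : ℕ} {Y₀ Y₀' : AbelianVariety ℂ}
    (hY : Y₀.IsIsogenous (E.powSucc a)) (hY' : Y₀'.IsIsogenous (E.powSucc b)) : CMSpreadingAt (Y₀.prod Y₀') :=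
  cmSpreadingAt_of_hodgeConjectureFor
    (Hypotheses.EllipticCurve.hodgeConjectureFor_prod_of_isIsogenous_powSucc_of_cm hE φ hd hφ hY hY')

variable {𝒳 S : SchemeOver ℂ}

/-- **Family form**: a fibre charted by a power of `E × Y₀`, `Y₀ ~ E^{K+1}`, lies in typer 2's ANCHOR LOCUS, so the
localised row U to it is tautological (part VII `cmSpreadingTo_of_mem_anchorLocus`) — `HC_CM` is not used at the
CM-power fibres of the `k`-line cells. [cite: vanGeemen1994HodgeAV, Thm. 4.3] [cite: Deligne1982HodgeCycles, §6 Prop. 6.1] -/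
theorem cmSpreadingTo_of_chart_powSucc_prod_of_isIsogenous_powSucc_of_cm {f : 𝒳 ⟶ S} {n : ℕ}
    {s : ComplexPoints S} (K : ℕ) {Y₀ : AbelianVariety ℂ} (hY : Y₀.IsIsogenous (E.powSucc K)) (M : ℕ)
    (e₀ : ((E.prod Y₀).powSucc M).X ≅ fiberOver f s) (hn : ((E.prod Y₀).powSucc M).dim = n) :
    CMSpreadingTo f n s :=
  cmSpreadingTo_of_mem_anchorLocus (mem_anchorLocus_of_chart e₀
    (hn ▸ hodgeConjectureFor_powSucc_prod_of_isIsogenous_powSucc_of_cm hE φ hd hφ K hY M))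

end CMPowers

/-- **Powers of a SIMPLE abelian variety of PRIME dimension are anchors modulo Tankeev–Ribet** (refereed named fact,
binder `h`; no `HC_CM`): HC holds at every abelian variety isogenous to `B^{N+1}`. Prime `3`: the CM fibres `~ B²`
(`B` a simple CM threefold) of the type III(1) sixfold families `S_{D,Ψ}`; prime `2`: part VIII's surface case.
[cite: MoonenZarhin1999LowDim, §2 Thm. (2.7)] [cite: vanGeemen1994HodgeAV, Lemma 3.7, Thm. 4.6] -/
theorem hodgeConjectureFor_of_isIsogenous_powSucc_simplePrimeDim_of_tankeevRibet
    (h : TankeevRibet1983_hodgeClasses_divisorial_powers_simplePrimeDimension) (B : AbelianVariety ℂ) {p : ℕ}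
    (hp : p.Prime) (hB : B.dim = p) (hs : B.IsSimple) (N : ℕ) {A : AbelianVariety ℂ}
    (hA : A.IsIsogenous (B.powSucc N)) : HodgeConjectureFor A.dim A.X :=
  HodgeConjectureFor.of_isIsogenous hA (hodgeConjectureFor_powSucc_of_tankeevRibet h B hp hB hs N)

/-- … hence the localised row U holds there, modulo Tankeev–Ribet only (type III(1) sixfold cell at its
simple-threefold CM fibres: KIND 1 on the deformation axis). [cite: MoonenZarhin1999LowDim, §2 Thm. (2.7)] -/
theorem cmSpreadingAt_of_isIsogenous_powSucc_simplePrimeDim_of_tankeevRibet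
    (h : TankeevRibet1983_hodgeClasses_divisorial_powers_simplePrimeDimension) (B : AbelianVariety ℂ) {p : ℕ}
    (hp : p.Prime) (hB : B.dim = p) (hs : B.IsSimple) (N : ℕ) {A : AbelianVariety ℂ}
    (hA : A.IsIsogenous (B.powSucc N)) : CMSpreadingAt A :=
  cmSpreadingAt_of_hodgeConjectureFor
    (hodgeConjectureFor_of_isIsogenous_powSucc_simplePrimeDim_of_tankeevRibet h B hp hB hs N hA)

/-- **The quaternion-sixfold cell at a fibre `A ~ B²`, `B` a simple threefold**: HC(`A`) modulo Tankeev–Ribet, no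
`HC_CM` (`B.powSucc 1 = B × B`). [cite: MoonenZarhin1999LowDim, §2 Thm. (2.7)] [cite: Abdulali2002TypeIII, §4] -/
theorem hodgeConjectureFor_of_isIsogenous_sq_simpleThreefold_of_tankeevRibet
    (h : TankeevRibet1983_hodgeClasses_divisorial_powers_simplePrimeDimension) (B : AbelianVariety ℂ)
    (hB : B.dim = 3) (hs : B.IsSimple) {A : AbelianVariety ℂ} (hA : A.IsIsogenous (B.prod B)) :
    HodgeConjectureFor A.dim A.X :=
  hodgeConjectureFor_of_isIsogenous_powSucc_simplePrimeDim_of_tankeevRibet h B Nat.prime_three hB hs 1 hA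

/-- **The K3-partner cell at its CM fibres, `E` cyclic: HC for `X ~ Y₀ × Z` with `Y₀ ~ B × B` and `Z ~ B`, `B` a
simple abelian surface — modulo Tankeev–Ribet (prime `2`), no `HC_CM`.** At the `E × E`-tori of the Shimura curve of
a quartic-field type-IV fourfold `Y` the fibre `Y₀` splits as `B_{Φ₁} × B_{Φ₂}` with `Φ₂ = Φ₁ ∘ α`,
`α ∈ Gal(E/ℚ) ≅ C₄`, so `Y₀ ~ B²`, and the K3 partner `Z_Y` is `~ B` (one isogeny class of surfaces with CM by a
cyclic quartic field: Moonen–Zarhin §4, arXiv p. 8, "In case (1) there is only one isogeny class of abelian surfaces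
with CM by `F`"); RING2-MAP D.41. The kernel takes the isogeny shape as hypothesis.
[cite: MoonenZarhin1999LowDim, §2 Thm. (2.7) and §4 (quartic-CM-field dichotomy, arXiv p. 8)]
[cite: vanGeemen1994HodgeAV, Lemma 3.7] -/
theorem hodgeConjectureFor_of_isIsogenous_prod_sq_of_tankeevRibet
    (h : TankeevRibet1983_hodgeClasses_divisorial_powers_simplePrimeDimension) (B : AbelianVariety ℂ)
    (hB : B.dim = 2) (hs : B.IsSimple) {X Y₀ Z : AbelianVariety ℂ} (hX : X.IsIsogenous (Y₀.prod Z))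
    (hY : Y₀.IsIsogenous (B.prod B)) (hZ : Z.IsIsogenous B) : HodgeConjectureFor X.dim X.X :=
  hodgeConjectureFor_of_isIsogenous_powSucc_simplePrimeDim_of_tankeevRibet h B Nat.prime_two hB hs 2
    (hX.trans (hY.prod hZ))

/-- … hence the localised row U holds at those fibres WITHOUT `HC_CM`: on the Shimura curve of `Y` (times the point
`Z_Y`) the K3-partner cell is `U`-only at `E` cyclic (KIND 1; at `E` of type `D₄` it is not — D.41).
[cite: MoonenZarhin1999LowDim, §4 (quartic-CM-field dichotomy, arXiv p. 8)] [cite: Deligne1982HodgeCycles, §6 Prop. 6.1] -/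
theorem cmSpreadingAt_of_isIsogenous_prod_sq_of_tankeevRibet
    (h : TankeevRibet1983_hodgeClasses_divisorial_powers_simplePrimeDimension) (B : AbelianVariety ℂ)
    (hB : B.dim = 2) (hs : B.IsSimple) {X Y₀ Z : AbelianVariety ℂ} (hX : X.IsIsogenous (Y₀.prod Z))
    (hY : Y₀.IsIsogenous (B.prod B)) (hZ : Z.IsIsogenous B) : CMSpreadingAt X :=
  cmSpreadingAt_of_hodgeConjectureFor (hodgeConjectureFor_of_isIsogenous_prod_sq_of_tankeevRibet h B hB hs hX hY hZ)

variable {𝒳 S : SchemeOver ℂ}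

/-- **Family form, prime dimension**: a fibre charted by `A₀ ~ B^{N+1}`, `B` simple of prime dimension, lies in the
anchor locus modulo Tankeev–Ribet; the localised row U to it is then tautological.
[cite: MoonenZarhin1999LowDim, §2 Thm. (2.7)] [cite: Deligne1982HodgeCycles, §6 Prop. 6.1] -/
theorem cmSpreadingTo_of_chart_of_isIsogenous_powSucc_simplePrimeDim_of_tankeevRibet
    (h : TankeevRibet1983_hodgeClasses_divisorial_powers_simplePrimeDimension) {f : 𝒳 ⟶ S} {n : ℕ}
    {s : ComplexPoints S} (A₀ : AbelianVariety ℂ) (e₀ : A₀.X ≅ fiberOver f s) (hdim : A₀.dim = n)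
    (B : AbelianVariety ℂ) {p : ℕ} (hp : p.Prime) (hB : B.dim = p) (hs : B.IsSimple) (N : ℕ)
    (hiso : A₀.IsIsogenous (B.powSucc N)) : CMSpreadingTo f n s :=
  cmSpreadingTo_of_mem_anchorLocus (mem_anchorLocus_of_chart e₀
    (hdim ▸ hodgeConjectureFor_of_isIsogenous_powSucc_simplePrimeDim_of_tankeevRibet h B hp hB hs N hiso))

/-- **Family form, K3-partner cell at `E` cyclic**: a fibre charted by `X₀ ~ Y₀ × Z`, `Y₀ ~ B × B`, `Z ~ B`, `B` a
simple surface, lies in the anchor locus modulo Tankeev–Ribet; the localised row U to it is tautological.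
[cite: MoonenZarhin1999LowDim, §4 (quartic-CM-field dichotomy, arXiv p. 8)] [cite: Deligne1982HodgeCycles, §6 Prop. 6.1] -/
theorem cmSpreadingTo_of_chart_of_isIsogenous_prod_sq_of_tankeevRibet
    (h : TankeevRibet1983_hodgeClasses_divisorial_powers_simplePrimeDimension) {f : 𝒳 ⟶ S} {n : ℕ}
    {s : ComplexPoints S} (X₀ : AbelianVariety ℂ) (e₀ : X₀.X ≅ fiberOver f s) (hdim : X₀.dim = n)
    (B : AbelianVariety ℂ) (hB : B.dim = 2) (hs : B.IsSimple) {Y₀ Z : AbelianVariety ℂ}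
    (hX : X₀.IsIsogenous (Y₀.prod Z)) (hY : Y₀.IsIsogenous (B.prod B)) (hZ : Z.IsIsogenous B) :
    CMSpreadingTo f n s :=
  cmSpreadingTo_of_mem_anchorLocus (mem_anchorLocus_of_chart e₀
    (hdim ▸ hodgeConjectureFor_of_isIsogenous_prod_sq_of_tankeevRibet h B hB hs hX hY hZ))

end Summit.HodgeConjecture.HodgeConjecture.Ring2.Deform
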